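import Summits.Ventures.Crystal3D.Bulk.GapKiteRowMono
import HarnessLib

/-!
# Almost-monotone kite rows: if the quadratic is only `≥ −ε` (a shallow dip), the row exceeds its
# end value by at most `7 ε · (length of the parameter interval)`

HONEST FRAMING. Part of the venture `Summits/Ventures/Crystal3D` (cell `pub-crystal3d`, phase 2;
seat p2, PROMOTION-AUDIT prep, memo r1.1 A6 (b1)). Kernel theorems about an ADMISSIBLE configuration
(`IsGapConfig c`; no extremality / convexity / face hypothesis) and pure real lemmas; nothing here
asserts anything about GAP(1.26); no count, head, class or grade word moves.

For a kite row `F = α u_a + c₂ u_p + c₄ u_b` along `x = ⟪u_b, p̂⟫` (`Bulk/GapKiteCalculus.lean`: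
`F' = 2q/((1 − y²)√Q)`): on the admissible range `(1 − y²)√Q ≥ (1/2)(4/7) = 2/7` (`y² ≤ D²/4 ≤ 1/2`,
`Q ≥ 1/3 ≥ (4/7)²` by concavity), so `q ≥ −ε` gives `F' ≥ −7ε` and
**`kiteRow_le_of_quad_ge_neg`**: `F(x₁) ≤ F(x₂) + 7ε(x₂ − x₁)`; mirror **`kiteRow_ge_of_quad_le`**.
Box certificates with slack (`kite_quad_ge_neg_of_cert`) and the certified configuration forms
**`IsGapConfig.kite_row_le_half_slack_of_cert`** / **`IsGapConfig.kite_row_le_flat_slack_of_cert`**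
(row ≤ end value + `7ε (X_hi − X_lo)`). Use: the four rows of `PZ4_W1` whose quadratic dips below
zero by `< 0.0064` on the cell (directions `±(1, 1, 0)`, rows 9 10 21 22).
-/

noncomputable section

open scoped BigOperators InnerProductSpace
open Finset Real Set

namespace Summit.Ventures.Crystal3D

/-! ## §1 Box certificates with slack -/

/-- **Box criterion with slack.** Lukács certificates for `q_{D_lo} + ε` and `q_{D_hi} + ε` on
`[X_lo, X_hi]` give `−ε ≤ q_D(y)` on the box (the quadratic is affine in `D`). -/
theorem kite_quad_ge_neg_of_cert {α c₂ c₄ ε Dlo Dhi Xlo Xhi p₁ v₁ m₁ l₁ p₂ v₂ m₂ l₂ D y : ℝ}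
    (hD1 : Dlo ≤ D) (hD2 : D ≤ Dhi) (hy1 : Xlo ≤ y) (hy2 : y ≤ Xhi)
    (hp₁ : 0 ≤ p₁) (hm₁ : 0 ≤ m₁) (hl₁ : 0 ≤ l₁) (hp₂ : 0 ≤ p₂) (hm₂ : 0 ≤ m₂) (hl₂ : 0 ≤ l₂)
    (h₁ : ∀ t : ℝ, α * t ^ 2 - (c₂ + c₄ * Dlo) * t + (c₂ * Dlo + c₄ - α) + ε =
      p₁ * (t - v₁) ^ 2 + m₁ + l₁ * ((t - Xlo) * (Xhi - t)))
    (h₂ : ∀ t : ℝ, α * t ^ 2 - (c₂ + c₄ * Dhi) * t + (c₂ * Dhi + c₄ - α) + ε =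
      p₂ * (t - v₂) ^ 2 + m₂ + l₂ * ((t - Xlo) * (Xhi - t))) :
    -ε ≤ α * y ^ 2 - (c₂ + c₄ * D) * y + (c₂ * D + c₄ - α) := by
  have hw : 0 ≤ (y - Xlo) * (Xhi - y) := mul_nonneg (by linarith) (by linarith)
  have q1 : 0 ≤ α * y ^ 2 - (c₂ + c₄ * Dlo) * y + (c₂ * Dlo + c₄ - α) + ε := by
    rw [h₁ y]; nlinarith [sq_nonneg (y - v₁), mul_nonneg hl₁ hw]
  have q2 : 0 ≤ α * y ^ 2 - (c₂ + c₄ * Dhi) * y + (c₂ * Dhi + c₄ - α) + ε := by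
    rw [h₂ y]; nlinarith [sq_nonneg (y - v₂), mul_nonneg hl₂ hw]
  have e : (Dhi - Dlo) * (α * y ^ 2 - (c₂ + c₄ * D) * y + (c₂ * D + c₄ - α) + ε) =
      (Dhi - D) * (α * y ^ 2 - (c₂ + c₄ * Dlo) * y + (c₂ * Dlo + c₄ - α) + ε) +
        (D - Dlo) * (α * y ^ 2 - (c₂ + c₄ * Dhi) * y + (c₂ * Dhi + c₄ - α) + ε) := by
    ring
  rcases eq_or_lt_of_le (hD1.trans hD2) with h | h
  · have hD : D = Dlo := le_antisymm (h ▸ hD2) hD1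
    rw [hD]; linarith
  · have hrhs : (Dhi - Dlo) * 0 ≤
        (Dhi - Dlo) * (α * y ^ 2 - (c₂ + c₄ * D) * y + (c₂ * D + c₄ - α) + ε) := by
      rw [mul_zero, e]
      exact add_nonneg (mul_nonneg (by linarith) q1) (mul_nonneg (by linarith) q2)
    have := le_of_mul_le_mul_left hrhs (by linarith)
    linarith

/-! ## §2 Almost-monotone rows -/

/-- Quantitative concavity of `Q`: for `x₁ ≤ y ≤ D/2`, `Q(y) ≥ min (Q(x₁), 3 − D²)`; here with the
common lower bound `1/3` (`Q(x₁) ≥ 1/3`, `D² ≤ 8/3`). -/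
theorem kiteQ_ge_third {D x₁ y : ℝ} (hD : D ^ 2 ≤ 8 / 3)
    (hQ : 1 / 3 ≤ 3 - D ^ 2 + 2 * D * x₁ - 4 * x₁ ^ 2) (h1 : x₁ ≤ y) (h2 : y ≤ D / 2) :
    1 / 3 ≤ 3 - D ^ 2 + 2 * D * y - 4 * y ^ 2 := by
  rcases eq_or_lt_of_le h1 with h | h
  · subst h; exact hQ
  have key : (D / 2 - x₁) * (3 - D ^ 2 + 2 * D * y - 4 * y ^ 2) =
      (D / 2 - y) * (3 - D ^ 2 + 2 * D * x₁ - 4 * x₁ ^ 2) + (y - x₁) * (3 - D ^ 2) +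
        4 * ((y - x₁) * (D / 2 - y)) * (D / 2 - x₁) := by
    ring
  have hpos : 0 < D / 2 - x₁ := by linarith
  have t3 : 0 ≤ 4 * ((y - x₁) * (D / 2 - y)) * (D / 2 - x₁) :=
    mul_nonneg (mul_nonneg (by norm_num) (mul_nonneg (by linarith) (by linarith))) hpos.le
  have h' : (D / 2 - x₁) * (1 / 3) ≤ (D / 2 - x₁) * (3 - D ^ 2 + 2 * D * y - 4 * y ^ 2) := by
    rw [key]
    nlinarith [mul_nonneg (sub_nonneg.2 h2) (sub_nonneg.2 hQ),
      mul_nonneg (sub_nonneg.2 h1) (show (0:ℝ) ≤ 3 - D ^ 2 - 1 / 3 by linarith)]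
  exact le_of_mul_le_mul_left h' hpos

/-- **Almost-increasing kite row.** For `0 < D`, `D² ≤ 2`, `−D/2 ≤ x₁ ≤ x₂ ≤ D/2`, `Q(x₁) ≥ 1/3`,
`0 ≤ ε` and `q ≥ −ε` on `[x₁, x₂]`: `F(x₁) ≤ F(x₂) + 7ε(x₂ − x₁)` (`F' ≥ −7ε` since
`(1 − y²)√Q ≥ 2/7`; mean value theorem for `F + 7ε·y`). [folklore] -/
theorem kiteRow_le_of_quad_ge_neg {D α c₂ c₄ ε x₁ x₂ : ℝ} (hD0 : 0 < D) (hD2 : D ^ 2 < 2)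
    (hx₁ : -(D / 2) ≤ x₁) (h12 : x₁ ≤ x₂) (hx₂ : x₂ ≤ D / 2)
    (hQ : 1 / 3 ≤ 3 - D ^ 2 + 2 * D * x₁ - 4 * x₁ ^ 2) (hε : 0 ≤ ε)
    (hq : ∀ y ∈ Icc x₁ x₂, -ε ≤ α * y ^ 2 - (c₂ + c₄ * D) * y + (c₂ * D + c₄ - α)) :
    α * arccos ((4 * x₁ - D) / (√3 * √(4 - D ^ 2))) +
        c₂ * arccos (((4 + D ^ 2) * x₁ ^ 2 - 4 * D * x₁ + D ^ 2 - 2) /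
          ((4 - D ^ 2) * (1 - x₁ ^ 2))) +
        c₄ * arccos ((5 * x₁ ^ 2 - 4 * D * x₁ + 2 * D ^ 2 - 3) / (3 * (1 - x₁ ^ 2))) ≤
      α * arccos ((4 * x₂ - D) / (√3 * √(4 - D ^ 2))) +
        c₂ * arccos (((4 + D ^ 2) * x₂ ^ 2 - 4 * D * x₂ + D ^ 2 - 2) /
          ((4 - D ^ 2) * (1 - x₂ ^ 2))) +
        c₄ * arccos ((5 * x₂ ^ 2 - 4 * D * x₂ + 2 * D ^ 2 - 3) / (3 * (1 - x₂ ^ 2))) +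
      7 * ε * (x₂ - x₁) := by
  have hD4 : D ^ 2 < 4 := by linarith
  -- derivative of `G = F + 7ε·y` at every point of `[x₁, x₂]`, and its sign
  have hder : ∀ y ∈ Icc x₁ x₂, HasDerivAt
      (fun y : ℝ => α * arccos ((4 * y - D) / (√3 * √(4 - D ^ 2))) +
        c₂ * arccos (((4 + D ^ 2) * y ^ 2 - 4 * D * y + D ^ 2 - 2) /
          ((4 - D ^ 2) * (1 - y ^ 2))) +
        c₄ * arccos ((5 * y ^ 2 - 4 * D * y + 2 * D ^ 2 - 3) / (3 * (1 - y ^ 2))) + 7 * ε * y)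
      (2 * (α * y ^ 2 - (c₂ + c₄ * D) * y + (c₂ * D + c₄ - α)) /
        ((1 - y ^ 2) * √(3 - D ^ 2 + 2 * D * y - 4 * y ^ 2)) + 7 * ε) y ∧
      0 ≤ 2 * (α * y ^ 2 - (c₂ + c₄ * D) * y + (c₂ * D + c₄ - α)) /
        ((1 - y ^ 2) * √(3 - D ^ 2 + 2 * D * y - 4 * y ^ 2)) + 7 * ε := by
    intro y hy
    have hy2 : y ≤ D / 2 := hy.2.trans hx₂
    have hQ3 := kiteQ_ge_third (by linarith) hQ hy.1 hy2
    have hQy : 0 < 3 - D ^ 2 + 2 * D * y - 4 * y ^ 2 := by linarith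
    have hDy2 : D * y ≤ D * (D / 2) := mul_le_mul_of_nonneg_left hy2 hD0.le
    have hysq : y ^ 2 ≤ D ^ 2 / 4 := by nlinarith [hy.1, hx₁, hy2]
    have hysq1 : y ^ 2 < 1 := by nlinarith
    have hyD : y < D := by nlinarith
    have hDy : D * y < 1 := by nlinarith
    have h := ((((hasDerivAt_kiteUa D y hD4 hQy).const_mul α).add
      ((hasDerivAt_kiteUp D y hysq1 hDy hD4 hQy).const_mul c₂)).add
      ((hasDerivAt_kiteUb D y hysq1 hyD hQy).const_mul c₄)).add
      ((hasDerivAt_id' y).const_mul (7 * ε))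
    have hsQ : √(3 - D ^ 2 + 2 * D * y - 4 * y ^ 2) ≠ 0 := (Real.sqrt_pos.2 hQy).ne'
    have hy1 : 1 - y ^ 2 ≠ 0 := by linarith
    refine ⟨h.congr_deriv (by field_simp; ring), ?_⟩
    -- sign: `(1 − y²)√Q ≥ (1/2)(4/7) = 2/7`
    have hsq : 4 / 7 ≤ √(3 - D ^ 2 + 2 * D * y - 4 * y ^ 2) := by
      rw [show (4 / 7 : ℝ) = √((4 / 7) ^ 2) by rw [Real.sqrt_sq (by norm_num)]]
      exact Real.sqrt_le_sqrt (by linarith)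
    have hw : 2 / 7 ≤ (1 - y ^ 2) * √(3 - D ^ 2 + 2 * D * y - 4 * y ^ 2) := by
      nlinarith [Real.sqrt_nonneg (3 - D ^ 2 + 2 * D * y - 4 * y ^ 2)]
    have hwpos : 0 < (1 - y ^ 2) * √(3 - D ^ 2 + 2 * D * y - 4 * y ^ 2) := by linarith
    rw [div_add' _ _ _ hwpos.ne']
    apply div_nonneg _ hwpos.le
    nlinarith [hq y hy, mul_le_mul_of_nonneg_left hw hε]
  have hcont : ContinuousOn
      (fun y : ℝ => α * arccos ((4 * y - D) / (√3 * √(4 - D ^ 2))) +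
        c₂ * arccos (((4 + D ^ 2) * y ^ 2 - 4 * D * y + D ^ 2 - 2) /
          ((4 - D ^ 2) * (1 - y ^ 2))) +
        c₄ * arccos ((5 * y ^ 2 - 4 * D * y + 2 * D ^ 2 - 3) / (3 * (1 - y ^ 2))) + 7 * ε * y)
      (Icc x₁ x₂) :=
    fun y hy => (hder y hy).1.continuousAt.continuousWithinAt
  have hmono := monotoneOn_of_hasDerivWithinAt_nonneg (convex_Icc x₁ x₂) hcont
    (fun y hy => ((hder y (by rw [interior_Icc] at hy; exact Ioo_subset_Icc_self hy)).1).hasDerivWithinAt)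
    (fun y hy => (hder y (by rw [interior_Icc] at hy; exact Ioo_subset_Icc_self hy)).2)
  have h := hmono (left_mem_Icc.2 h12) (right_mem_Icc.2 h12) h12
  simp only at h
  linarith

/-- **Almost-decreasing kite row** (mirror): `q ≤ ε` on `[x₁, x₂]` gives
`F(x₂) ≤ F(x₁) + 7ε(x₂ − x₁)`. [folklore] -/
theorem kiteRow_ge_of_quad_le {D α c₂ c₄ ε x₁ x₂ : ℝ} (hD0 : 0 < D) (hD2 : D ^ 2 < 2)
    (hx₁ : -(D / 2) ≤ x₁) (h12 : x₁ ≤ x₂) (hx₂ : x₂ ≤ D / 2)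
    (hQ : 1 / 3 ≤ 3 - D ^ 2 + 2 * D * x₁ - 4 * x₁ ^ 2) (hε : 0 ≤ ε)
    (hq : ∀ y ∈ Icc x₁ x₂, α * y ^ 2 - (c₂ + c₄ * D) * y + (c₂ * D + c₄ - α) ≤ ε) :
    α * arccos ((4 * x₂ - D) / (√3 * √(4 - D ^ 2))) +
        c₂ * arccos (((4 + D ^ 2) * x₂ ^ 2 - 4 * D * x₂ + D ^ 2 - 2) /
          ((4 - D ^ 2) * (1 - x₂ ^ 2))) +
        c₄ * arccos ((5 * x₂ ^ 2 - 4 * D * x₂ + 2 * D ^ 2 - 3) / (3 * (1 - x₂ ^ 2))) ≤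
      α * arccos ((4 * x₁ - D) / (√3 * √(4 - D ^ 2))) +
        c₂ * arccos (((4 + D ^ 2) * x₁ ^ 2 - 4 * D * x₁ + D ^ 2 - 2) /
          ((4 - D ^ 2) * (1 - x₁ ^ 2))) +
        c₄ * arccos ((5 * x₁ ^ 2 - 4 * D * x₁ + 2 * D ^ 2 - 3) / (3 * (1 - x₁ ^ 2))) +
      7 * ε * (x₂ - x₁) := by
  have h := kiteRow_le_of_quad_ge_neg (α := -α) (c₂ := -c₂) (c₄ := -c₄) hD0 hD2 hx₁ h12 hx₂ hQ hε
    (fun y hy => by have := hq y hy; linarith)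
  linarith

/-! ## §3 Certified configuration forms -/

section Config

open Literature.Geometry.DiscreteGeometry InnerProductGeometry

variable {c : Fin 14 → EuclideanSpace ℝ (Fin 3)}

/-- The admissible parameter satisfies `Q(x) ≥ 1/3` and `x ≥ −D/2` (from `x ≤ D/2`,
`3x² − 2Dx + D² − 2 ≤ 0`, `1 ≤ D`). -/
theorem kite_param_bounds {D x : ℝ} (hD1 : 1 ≤ D) (hx : x ≤ D / 2)
    (hP : 3 * x ^ 2 - 2 * D * x + D ^ 2 - 2 ≤ 0) :
    1 / 3 ≤ 3 - D ^ 2 + 2 * D * x - 4 * x ^ 2 ∧ -(D / 2) ≤ x := by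
  constructor
  · nlinarith [mul_le_mul_of_nonneg_left hx (by linarith : (0:ℝ) ≤ D)]
  · nlinarith

/-- **Certified almost-increasing row on a `D`-cell**: certificates for `q + ε ≥ 0` on the box give
`α u₁ + c₂ u₂ + c₄ u₄ ≤ (α + 2c₄) A_x(D) + 2c₂ A_p(D) + 7ε (X_hi − X_lo)`. -/
theorem IsGapConfig.kite_row_le_half_slack_of_cert (hc : IsGapConfig c) {Dlo Dhi Xlo Xhi ε : ℝ}
    (hlo : Dlo ≤ intruderDist c) (hhi : intruderDist c ≤ Dhi) (hDlo : 0 ≤ Dlo) (hDhi : Dhi ^ 2 < 2)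
    (hX1 : 6 - 2 * Dlo ^ 2 ≤ (Dlo - 3 * Xlo) ^ 2) (hX2 : 3 * Xlo ≤ Dlo) (hX3 : Dhi / 2 ≤ Xhi) (hε : 0 ≤ ε)
    {a e b : Fin 14} (ha0 : a ≠ 0) (ha13 : a ≠ 13) (he0 : e ≠ 0) (he13 : e ≠ 13) (hb0 : b ≠ 0)
    (hb13 : b ≠ 13) (hae : a ≠ e) (ha : dist (c a) (c 13) = 1) (he : dist (c e) (c 13) = 1)
    (hba : dist (c b) (c a) = 1) (hbe : dist (c b) (c e) = 1) (α c₂ c₄ : ℝ)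
    {p₁ v₁ m₁ l₁ p₂ v₂ m₂ l₂ : ℝ}
    (hp₁ : 0 ≤ p₁) (hm₁ : 0 ≤ m₁) (hl₁ : 0 ≤ l₁) (hp₂ : 0 ≤ p₂) (hm₂ : 0 ≤ m₂) (hl₂ : 0 ≤ l₂)
    (h₁ : ∀ t : ℝ, α * t ^ 2 - (c₂ + c₄ * Dlo) * t + (c₂ * Dlo + c₄ - α) + ε =
      p₁ * (t - v₁) ^ 2 + m₁ + l₁ * ((t - Xlo) * (Xhi - t)))
    (h₂ : ∀ t : ℝ, α * t ^ 2 - (c₂ + c₄ * Dhi) * t + (c₂ * Dhi + c₄ - α) + ε =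
      p₂ * (t - v₂) ^ 2 + m₂ + l₂ * ((t - Xlo) * (Xhi - t))) :
    α * corner c a 13 b + c₂ * corner c 13 a e + c₄ * corner c b a e ≤
      (α + 2 * c₄) * Real.arccos (intruderDist c / (√3 * √(4 - intruderDist c ^ 2))) +
        2 * c₂ * Real.arccos ((2 - intruderDist c ^ 2) / (4 - intruderDist c ^ 2)) +
        7 * ε * (Xhi - Xlo) := by
  have hD1 : 1 ≤ intruderDist c := hc.one_le_intruderDist
  have hD0 : 0 < intruderDist c := by linarith
  have hD2 : intruderDist c ^ 2 < 2 := by nlinarith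
  obtain ⟨hx, hP, h1, h2, h3⟩ :=
    hc.kite_on_curve hD2.le ha0 ha13 he0 he13 hb0 hb13 hae ha he hba hbe
  obtain ⟨hQ3, hxlo⟩ := kite_param_bounds hD1 hx hP
  have hXf : Xlo ≤ (intruderDist c - √(6 - 2 * intruderDist c ^ 2)) / 3 :=
    (kite_le_flat_of_sq hX1 hX2).trans (kite_flat_mono hDlo hlo)
  have hxX : Xlo ≤ ⟪gapDir c b, gapDir c 13⟫_ℝ := hXf.trans (kite_flat_le (by linarith) hP)
  have hmono := kiteRow_le_of_quad_ge_neg (α := α) (c₂ := c₂) (c₄ := c₄) hD0 hD2 hxlo hx le_rfl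
    hQ3 hε (fun y hy => kite_quad_ge_neg_of_cert (Xlo := Xlo) (Xhi := Xhi) hlo hhi (hxX.trans hy.1)
      (by linarith [hy.2])
      hp₁ hm₁ hl₁ hp₂ hm₂ hl₂ h₁ h₂)
  rw [kiteUa_at_half, kiteUp_at_half hD2.le, kiteUb_at_half hD0.le (by linarith)] at hmono
  rw [h1, h2, h3]
  have hlen : 7 * ε * (intruderDist c / 2 - ⟪gapDir c b, gapDir c 13⟫_ℝ) ≤ 7 * ε * (Xhi - Xlo) :=
    mul_le_mul_of_nonneg_left (by linarith) (by linarith)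
  linarith

/-- **Certified almost-decreasing row on a `D`-cell** (certificates for `ε − q ≥ 0`):
`α u₁ + c₂ u₂ + c₄ u₄ ≤ α A_x(D) + c₂ A_p(D) + (α + c₄) α₀ + 7ε (X_hi − X_lo)`. -/
theorem IsGapConfig.kite_row_le_flat_slack_of_cert (hc : IsGapConfig c) {Dlo Dhi Xlo Xhi ε : ℝ}
    (hlo : Dlo ≤ intruderDist c) (hhi : intruderDist c ≤ Dhi) (hDlo : 0 ≤ Dlo) (hDhi : Dhi ^ 2 < 2)
    (hX1 : 6 - 2 * Dlo ^ 2 ≤ (Dlo - 3 * Xlo) ^ 2) (hX2 : 3 * Xlo ≤ Dlo) (hX3 : Dhi / 2 ≤ Xhi) (hε : 0 ≤ ε)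
    {a e b : Fin 14} (ha0 : a ≠ 0) (ha13 : a ≠ 13) (he0 : e ≠ 0) (he13 : e ≠ 13) (hb0 : b ≠ 0)
    (hb13 : b ≠ 13) (hae : a ≠ e) (ha : dist (c a) (c 13) = 1) (he : dist (c e) (c 13) = 1)
    (hba : dist (c b) (c a) = 1) (hbe : dist (c b) (c e) = 1) (α c₂ c₄ : ℝ)
    {p₁ v₁ m₁ l₁ p₂ v₂ m₂ l₂ : ℝ}
    (hp₁ : 0 ≤ p₁) (hm₁ : 0 ≤ m₁) (hl₁ : 0 ≤ l₁) (hp₂ : 0 ≤ p₂) (hm₂ : 0 ≤ m₂) (hl₂ : 0 ≤ l₂)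
    (h₁ : ∀ t : ℝ, -(α * t ^ 2 - (c₂ + c₄ * Dlo) * t + (c₂ * Dlo + c₄ - α)) + ε =
      p₁ * (t - v₁) ^ 2 + m₁ + l₁ * ((t - Xlo) * (Xhi - t)))
    (h₂ : ∀ t : ℝ, -(α * t ^ 2 - (c₂ + c₄ * Dhi) * t + (c₂ * Dhi + c₄ - α)) + ε =
      p₂ * (t - v₂) ^ 2 + m₂ + l₂ * ((t - Xlo) * (Xhi - t))) :
    α * corner c a 13 b + c₂ * corner c 13 a e + c₄ * corner c b a e ≤
      α * Real.arccos (intruderDist c / (√3 * √(4 - intruderDist c ^ 2))) +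
        c₂ * Real.arccos ((2 - intruderDist c ^ 2) / (4 - intruderDist c ^ 2)) +
        (α + c₄) * Real.arccos (1 / 3) + 7 * ε * (Xhi - Xlo) := by
  have hD1 : 1 ≤ intruderDist c := hc.one_le_intruderDist
  have hD0 : 0 < intruderDist c := by linarith
  have hD2 : intruderDist c ^ 2 < 2 := by nlinarith
  obtain ⟨hx, hP, h1, h2, h3⟩ :=
    hc.kite_on_curve hD2.le ha0 ha13 he0 he13 hb0 hb13 hae ha he hba hbe
  obtain ⟨hroot, h3x⟩ := kite_flat_root (D := intruderDist c) (by linarith)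
  have hfl := kite_flat_le (D := intruderDist c) (by linarith) hP
  have hfh := kite_flat_le_half (D := intruderDist c) hD0.le
  obtain ⟨hQf, hflo⟩ := kite_param_bounds hD1 hfh hroot.le
  have hXf : Xlo ≤ (intruderDist c - √(6 - 2 * intruderDist c ^ 2)) / 3 :=
    (kite_le_flat_of_sq hX1 hX2).trans (kite_flat_mono hDlo hlo)
  have hmono := kiteRow_ge_of_quad_le (α := α) (c₂ := c₂) (c₄ := c₄) hD0 hD2 hflo hfl hx hQf hε
    (fun y hy => by
      have := kite_quad_ge_neg_of_cert (α := -α) (c₂ := -c₂) (c₄ := -c₄) (ε := ε) (Xlo := Xlo)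
        (Xhi := Xhi) (p₁ := p₁) (v₁ := v₁) (m₁ := m₁) (l₁ := l₁) (p₂ := p₂) (v₂ := v₂) (m₂ := m₂)
        (l₂ := l₂) hlo hhi
        (hXf.trans hy.1) (by linarith [hy.2]) hp₁ hm₁ hl₁ hp₂ hm₂ hl₂
        (fun t => by rw [← h₁ t]; ring) (fun t => by rw [← h₂ t]; ring)
      linarith)
  have hxb2 : ((intruderDist c - √(6 - 2 * intruderDist c ^ 2)) / 3) ^ 2 < 1 := by
    nlinarith [mul_le_mul_of_nonneg_left hfh hD0.le]
  rw [kiteUa_at_flat hD0.le (by linarith) h3x hroot, kiteUp_at_flat (by linarith) hxb2 hroot,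
    kiteUb_at_flat hxb2 hroot] at hmono
  rw [h1, h2, h3]
  have hlen : 7 * ε * (⟪gapDir c b, gapDir c 13⟫_ℝ -
      (intruderDist c - √(6 - 2 * intruderDist c ^ 2)) / 3) ≤ 7 * ε * (Xhi - Xlo) :=
    mul_le_mul_of_nonneg_left (by linarith) (by linarith)
  linarith

end Config

end Summit.Ventures.Crystal3D

end
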